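import Summits.PneNP.PneNP.Theorems.OneSliceSliceTargetSplit
import Summits.PneNP.PneNP.Theorems.SliceTarget.Negative.GeneralCircuits

/-!
# `MonotoneContinuation` (stmt-PneNP-18471, route PneNP/OneSlice) — negative-side lemmas I: read-back, and the source
# circuit's monotonicity is decoration

Standing-adversary (cdisprove) output for the crux `Summit.PneNP.PneNP.Theses.OneSlice.MonotoneContinuation` (MC):
`∀ c ∃ c' ∀ k ≥ 3 ∀ η > 0 ∃ ε > 0 ∀ᶠ n ∀ j` central `∀ C` over `{∧₂,∨₂}` with `|C| ≤ n^c`: if the slice-`j` transport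
`T_j 𝟙[C]` is `ε`-close in `L¹(G(n,p_c))` to some monotone Boolean function then it is `η`-close to `𝟙[C']` for a
`{∧₂,∨₂}`-circuit `C'` with `|C'| ≤ n^{c'}`. The crux is NOT refuted here; this file records, as theorems:

* §0 `monotoneContinuation_iff` — read-back in the vocabulary of the split files (`ContOver B c c' k η ε`; the inline
  distance is `l1 n (pc n k) (ind ·) (transport j (ind C.eval))` by `rdist_eq_l1`).
* §1 `monotoneContinuation_iff_B2` — **MC ↔ MC with GENERAL `B₂` source circuits** (Berkowitz on the slice, tree theorem
  `sliceMonotonization_proof`, exponent `c ↦ c + c₀ + 1`; the transport only reads the slice function,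
  `transport_congr_slice`): the hypothesis `C.IsOver monotoneBasis` on the SOURCE circuit is not load-bearing, MC is a statement
  about the transports of arbitrary small-circuit slice functions. `not_monotoneContinuation_iff_B2` — what a kill must deliver:
  ONE `c` such that for EVERY `c'` some `k ≥ 3`, `η > 0` admit, for every `ε > 0`, infinitely often a `B₂`-circuit of size
  `≤ n^c` whose slice transport is `ε`-close to a monotone Boolean function yet `η`-far from all `{∧₂,∨₂}`-circuits of size
  `≤ n^{c'}` — a superpolynomial AVERAGE-CASE monotone-vs-general separation at one critical product measure (none is known:
  Rossman's `n^{k/4}` two-threshold bound and every fixed-exponent gap cannot serve because `c` is fixed before `c'`).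

Work file with the running commentary and the load-bearing analysis of the closeness hypothesis (star-parity witness):
`Summits/PneNP/PneNP/Cruxes/MonotoneContinuation/Disproof.lean`. Refuter seat refuter-cdisprove-stmt-PneNP-18471-0, 2026-08-17.
-/

set_option linter.dupNamespace false

namespace Summit.PneNP.PneNP.Theorems.MonotoneContinuation.Negative

open Literature.Computability.Complexity hiding supp mem_supp
open Finset hiding slice
open Filter hiding mem_sdiff
open Classical
open Summit.PneNP.PneNP.Theses.OneSlice (MonotoneContinuation SliceMonotonization)
open Summit.PneNP.PneNP.Theorems.ConstantBand.Negative (Edge thr Central central_thr slice)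
open Summit.PneNP.PneNP.Theorems.SingleThreshold.Negative (pc)
open Summit.PneNP.PneNP.Theorems.SliceTargetSplit (nbhd mem_nbhd transport ind l1 rdist_eq_l1)
open Summit.PneNP.PneNP.Theorems.SliceTarget.Negative (monotoneBasis_subset_B2 eventually_central_pos_lt
  eventually_monotonization_small)

noncomputable section

/-! ## §0 Read-back: the schedule form of the item -/

/-- The continuation clause at fixed parameters `(c, c', k, η, ε)`, for source circuits over the basis `B`:
eventually in `n`, for every central `j` and every `B`-circuit `C` with `|C| ≤ n^c` whose slice-`j` transport is
`ε`-close in `L¹(G(n,p_c))` to a monotone Boolean function, some `{∧₂,∨₂}`-circuit of size `≤ n^{c'}` is `η`-close to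
that transport. [folklore] -/
def ContOver (B : Set GateFn) (c c' k : ℕ) (η ε : ℝ) : Prop :=
  ∀ᶠ n : ℕ in atTop, ∀ j : ℕ, Central k n j → ∀ C : Circuit (Edge n), C.IsOver B → C.size ≤ n ^ c →
    (∃ F : (Edge n → Bool) → Bool, Monotone F ∧ l1 n (pc n k) (ind F) (transport j (ind C.eval)) ≤ ε) →
    ∃ C' : Circuit (Edge n), C'.IsOver monotoneBasis ∧ C'.size ≤ n ^ c' ∧
      l1 n (pc n k) (ind C'.eval) (transport j (ind C.eval)) ≤ η

/-- **Read-back.** `MonotoneContinuation` is `∀ c ∃ c' ∀ k ≥ 3 ∀ η > 0 ∃ ε > 0, ContOver monotoneBasis c c' k η ε`: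
the inline weight is `gnpWeight n (pc n k)`, the inline ratio is the transport `T_j 𝟙[C]` of the split files
(`rdist_eq_l1`), the inline window is `Central`. [folklore] -/
theorem monotoneContinuation_iff :
    MonotoneContinuation ↔ ∀ c : ℕ, ∃ c' : ℕ, ∀ k : ℕ, 3 ≤ k → ∀ η : ℝ, 0 < η → ∃ ε : ℝ, 0 < ε ∧
      ContOver monotoneBasis c c' k η ε := by
  unfold MonotoneContinuation ContOver
  simp only [rdist_eq_l1]
  rfl

/-! ## §1 The source circuit's monotonicity is decoration: MC ↔ MC for `B₂` sources -/

/-- The transport only reads the slice: slice-equal functions have equal transports. [folklore] -/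
theorem transport_congr_slice {n j : ℕ} {g h : (Edge n → Bool) → ℝ} (hgh : ∀ x, edgeCount x = j → g x = h x)
    (y : Edge n → Bool) : transport j g y = transport j h y := by
  unfold transport
  rw [sum_congr rfl fun x hx => hgh x (mem_nbhd.1 hx).1]

/-- A smaller source basis gives a weaker clause. [folklore] -/
theorem ContOver.anti_basis {B B' : Set GateFn} (h : B ⊆ B') {c c' k : ℕ} {η ε : ℝ} (H : ContOver B' c c' k η ε) :
    ContOver B c c' k η ε := by
  filter_upwards [H] with n hn j hj C hC hs hF
  exact hn j hj C (hC.mono h) hs hF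

/-- **MC ⟹ MC for `B₂` sources** (modulo Berkowitz's monotonization with constant `c₀`): a `B₂`-circuit `D` with
`|D| ≤ n^c` monotonizes on the central slice `j` (`0 < j < C(n,2)` eventually) to a `{∧₂,∨₂}`-circuit with the SAME slice
function — hence the same transport — and `≤ c₀(n^c + n^{c₀}) < n^{c+c₀+1}` gates; apply MC at exponent `c + c₀ + 1`. [folklore] -/
theorem monotoneContinuationB2_of_monotoneContinuation (hM : SliceMonotonization) (h : MonotoneContinuation) :
    (∀ c : ℕ, ∃ c' : ℕ, ∀ k : ℕ, 3 ≤ k → ∀ η : ℝ, 0 < η → ∃ ε : ℝ, 0 < ε ∧ ContOver B2 c c' k η ε) := by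
  intro c
  obtain ⟨c₀, hc₀⟩ := hM
  obtain ⟨c', hc'⟩ := (monotoneContinuation_iff.1 h) (c + c₀ + 1)
  refine ⟨c', fun k hk η hη => ?_⟩
  obtain ⟨ε, hε, H⟩ := hc' k hk η hη
  refine ⟨ε, hε, ?_⟩
  filter_upwards [H, eventually_central_pos_lt hk, eventually_monotonization_small c c₀] with n hn hcen hsm j hj
    D hDB hDs hF
  obtain ⟨hj0, hjN⟩ := hcen j hj
  obtain ⟨C₁, hC₁B, hC₁s, hC₁e⟩ := hc₀ n j D hDB hj0 hjN
  have htr : transport j (ind C₁.eval) = transport j (ind D.eval) :=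
    funext fun y => transport_congr_slice (fun x hx => by simp only [ind, hC₁e x hx]) y
  have hsize : C₁.size ≤ n ^ (c + c₀ + 1) := by
    have : C₁.size ≤ c₀ * (n ^ c + n ^ c₀) :=
      hC₁s.trans (Nat.mul_le_mul_left _ (Nat.add_le_add_right hDs _))
    omega
  obtain ⟨C', hC', hs', hd'⟩ := hn j hj C₁ hC₁B hsize (by rwa [htr])
  exact ⟨C', hC', hs', by rwa [htr] at hd'⟩

/-- **MC ↔ MC for `B₂` sources** (modulo `SliceMonotonization`; the `B₂` form — `MonotoneContinuationB2` in the work file — is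
stated inline: the same schedule with GENERAL `B₂` source circuits, all sixteen fan-in-2 gates). [folklore] -/
theorem monotoneContinuation_iff_B2_of (hM : SliceMonotonization) :
    MonotoneContinuation ↔ (∀ c : ℕ, ∃ c' : ℕ, ∀ k : ℕ, 3 ≤ k → ∀ η : ℝ, 0 < η → ∃ ε : ℝ, 0 < ε ∧ ContOver B2 c c' k η ε) := by
  refine ⟨monotoneContinuationB2_of_monotoneContinuation hM, fun h => monotoneContinuation_iff.2 fun c => ?_⟩
  obtain ⟨c', hc'⟩ := h c
  exact ⟨c', fun k hk η hη => (hc' k hk η hη).imp fun ε hε => ⟨hε.1, hε.2.anti_basis monotoneBasis_subset_B2⟩⟩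

/-- **MC ↔ MC for `B₂` sources, unconditionally** (Berkowitz's monotonization is the tree theorem
`Summit.PneNP.PneNP.Theorems.sliceMonotonization_proof`): the hypothesis `C.IsOver monotoneBasis` of the item is not
load-bearing — the item speaks about the transports of arbitrary small-circuit slice functions. [folklore] -/
theorem monotoneContinuation_iff_B2 :
    MonotoneContinuation ↔ (∀ c : ℕ, ∃ c' : ℕ, ∀ k : ℕ, 3 ≤ k → ∀ η : ℝ, 0 < η → ∃ ε : ℝ, 0 < ε ∧ ContOver B2 c c' k η ε) :=
  monotoneContinuation_iff_B2_of Summit.PneNP.PneNP.Theorems.sliceMonotonization_proof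

/-- Negating the clause. [folklore] -/
theorem not_contOver_iff {B : Set GateFn} {c c' k : ℕ} {η ε : ℝ} :
    ¬ ContOver B c c' k η ε ↔ ∃ᶠ n : ℕ in atTop, ∃ j : ℕ, Central k n j ∧ ∃ C : Circuit (Edge n), C.IsOver B ∧
      C.size ≤ n ^ c ∧ (∃ F : (Edge n → Bool) → Bool, Monotone F ∧ l1 n (pc n k) (ind F) (transport j (ind C.eval)) ≤ ε) ∧
      ∀ C' : Circuit (Edge n), C'.IsOver monotoneBasis → C'.size ≤ n ^ c' →
        η < l1 n (pc n k) (ind C'.eval) (transport j (ind C.eval)) := by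
  unfold ContOver
  rw [not_eventually]
  refine ⟨fun h => h.mono fun n hn => ?_, fun h => h.mono fun n hn hall => ?_⟩
  · by_contra hcon
    apply hn
    intro j hj C hC hs hF
    by_contra hno
    refine hcon ⟨j, hj, C, hC, hs, hF, fun C' hC' hs' => ?_⟩
    by_contra hle
    exact hno ⟨C', hC', hs', not_lt.1 hle⟩
  · obtain ⟨j, hj, C, hC, hs, hF, hfar⟩ := hn
    obtain ⟨C', hC', hs', hd'⟩ := hall j hj C hC hs hF
    exact absurd hd' (not_le.2 (hfar C' hC' hs'))

/-- **What a kill must deliver** (general-circuit form): ONE exponent `c` such that for EVERY `c'` there are `k ≥ 3` and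
`η > 0` with, for every `ε > 0`, infinitely many `n` carrying a central `j` and a `B₂`-circuit `D`, `|D| ≤ n^c`, whose slice
transport is `ε`-close to a monotone Boolean function but `η`-far from every `{∧₂,∨₂}`-circuit of size `≤ n^{c'}` — a
superpolynomial average-case monotone-vs-general separation at the critical product measure (module docstring §3). [folklore] -/
theorem not_monotoneContinuation_iff_B2 :
    ¬ MonotoneContinuation ↔ ∃ c : ℕ, ∀ c' : ℕ, ∃ k : ℕ, 3 ≤ k ∧ ∃ η : ℝ, 0 < η ∧ ∀ ε : ℝ, 0 < ε →
      ∃ᶠ n : ℕ in atTop, ∃ j : ℕ, Central k n j ∧ ∃ D : Circuit (Edge n), D.IsOver B2 ∧ D.size ≤ n ^ c ∧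
        (∃ F : (Edge n → Bool) → Bool, Monotone F ∧ l1 n (pc n k) (ind F) (transport j (ind D.eval)) ≤ ε) ∧
        ∀ C' : Circuit (Edge n), C'.IsOver monotoneBasis → C'.size ≤ n ^ c' →
          η < l1 n (pc n k) (ind C'.eval) (transport j (ind D.eval)) := by
  rw [monotoneContinuation_iff_B2]
  simp only [not_forall, not_exists, not_and, not_contOver_iff.symm]
  refine exists_congr fun c => forall_congr' fun c' => ?_
  constructor
  · rintro ⟨k, hk, η, hη, h⟩
    exact ⟨k, hk, η, hη, fun ε hε hC => h ε hε hC⟩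
  · rintro ⟨k, hk, η, hη, h⟩
    exact ⟨k, hk, η, hη, fun ε hε hC => h ε hε hC⟩

end

end Summit.PneNP.PneNP.Theorems.MonotoneContinuation.Negative
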